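import Summits.KontsevichZagierPeriods.KontsevichZagierPeriods.Theorems.LinRedNormalFormArrangementNormalFormSeparateTwoCorner
import Summits.KontsevichZagierPeriods.KontsevichZagierPeriods.Theorems.LinRedNormalFormArrangementNormalFormSeparateTwoRadialLog

/-!
# The fibre mass along a nested thin sector: three-parameter comparison lemmas

(Line `janus-bands`, crux `ArrangementNormalForm`, stub `stub_separateHigh`, part `HHKMass` of
the wall-invariant termwise-split lemma `separateThree_hHk` in base dimension `3` with fibres.)
In base dimension `3` the local analysis of the Taylor pieces at a base point `z₁` uses NESTED
thin sectors `z₁ + t (d + v (Q + u S))`; every atom of the Janus fibre datum then has the value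
`c₀ c + t (p c + v (q c + u · r c))` (`c₀` = value at `z₁`, `p, q, r` = slopes along `d, Q, S`).
This part extends the two-parameter fibre-mass comparisons of parts `Corner`, `CornerLog`,
`RadialLog` to the third parameter `u`:
* `lmass_corner_mono3` (registered as `separateThreeHHK_mass`): moving towards the corner
  within ratio `4` in each of `t, v, u` costs a constant (`81^{k·#U} · 9^{k·#U}`);
* `lmass_tlog3`, `lmass_vlog3`, `lmass_ulog3`: contracting one of the three variables costs a
  power of a logarithm.
The `t`- and `v`-statements are the two-parameter lemmas with the transversal slope `q + u r`;
the `u`-statements are one more `SepTwo.lmass_contract` step about the anchors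
`c₀ + t (p + v q)` (values on the wall `u = 0` of the sector), whose separation `t v g'` scales
exactly like the core radius `2 t v u R`, so that the admissible range of `u` is uniform in `v`.
-/

noncomputable section

open Set MeasureTheory
open scoped ENNReal

namespace Summit.KontsevichZagierPeriods.ArrangementNormalForm.JanusBands

namespace SepHHK

open SepTwo

variable {k : ℕ} {ι : Type*}

/-- Rewriting the nested format `p + v (q + u r)` in the two-parameter format `p + (q + u r) v`. -/
theorem nest_eq (c₀ p q r : ι → ℝ) (t v u : ℝ) :
    (fun c => c₀ c + t * (p c + v * (q c + u * r c))) =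
      fun c => c₀ c + t * (p c + (q c + u * r c) * v) := by
  funext c; ring

/-- The transversal slope `q + u r` is bounded by `2R` for `|u| ≤ 1`. -/
theorem abs_q_add_le {q r : ι → ℝ} {U : Finset ι} {R : ℝ} (hRq : ∀ c ∈ U, |q c| ≤ R)
    (hRr : ∀ c ∈ U, |r c| ≤ R) {u : ℝ} (hu : |u| ≤ 1) :
    ∀ c ∈ U, |q c + u * r c| ≤ 2 * R := by
  intro c hc
  calc |q c + u * r c| ≤ |q c| + |u * r c| := abs_add_le _ _
    _ = |q c| + |u| * |r c| := by rw [abs_mul]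
    _ ≤ R + 1 * R := add_le_add (hRq c hc) (mul_le_mul hu (hRr c hc) (abs_nonneg _) zero_le_one)
    _ = 2 * R := by ring

/-- A bound `R` is also a bound `2R`. -/
theorem abs_le_two_mul {p : ι → ℝ} {U : Finset ι} {R : ℝ} (hR : 0 < R) (hRp : ∀ c ∈ U, |p c| ≤ R) :
    ∀ c ∈ U, |p c| ≤ 2 * R := fun c hc => (hRp c hc).trans (by linarith)

/-- **Separation of the anchors of the `u`-contraction.** The values `c₀ c + t (p c + v q c)` on
the wall `u = 0` of a nested sector at distinct anchors are `14 t v u' R`-separated as soon as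
`t ≤ G/(28R)`, `v ≤ min 1 (g/(16R))`, `u' ≤ min 1 (g'/(14R))`. -/
theorem anchors_sep3 (U : Finset ι) (c₀ p q : ι → ℝ) {G g g' R : ℝ} (hR : 0 < R)
    (hGsep : ∀ c ∈ U, ∀ c' ∈ U, c₀ c ≠ c₀ c' → G ≤ |c₀ c - c₀ c'|)
    (hgsep : ∀ c ∈ U, ∀ c' ∈ U, p c ≠ p c' → g ≤ |p c - p c'|)
    (hg'sep : ∀ c ∈ U, ∀ c' ∈ U, q c ≠ q c' → g' ≤ |q c - q c'|)
    (hRp : ∀ c ∈ U, |p c| ≤ R) (hRq : ∀ c ∈ U, |q c| ≤ R)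
    {t v u' : ℝ} (ht : 0 < t) (htG : t ≤ G / (28 * R)) (hv : 0 < v) (hv1 : v ≤ 1)
    (hvg : v ≤ g / (16 * R)) (hu'1 : u' ≤ 1) (hu'g : u' ≤ g' / (14 * R)) :
    ∀ c ∈ U, ∀ c' ∈ U, c₀ c + t * (p c + v * q c) ≠ c₀ c' + t * (p c' + v * q c') →
      7 * (2 * t * v * u' * R) ≤ |c₀ c + t * (p c + v * q c) - (c₀ c' + t * (p c' + v * q c'))| := by
  intro c hc c' hc' hne
  have hG28 : 28 * t * R ≤ G := by
    have := (le_div_iff₀ (by positivity : (0 : ℝ) < 28 * R)).1 htG; linarith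
  have hg16 : 16 * v * R ≤ g := by
    have := (le_div_iff₀ (by positivity : (0 : ℝ) < 16 * R)).1 hvg; linarith
  have hg'14 : 14 * u' * R ≤ g' := by
    have := (le_div_iff₀ (by positivity : (0 : ℝ) < 14 * R)).1 hu'g; linarith
  have hvu : v * u' ≤ 1 := by nlinarith
  have htvR : 0 < t * v * R := by positivity
  by_cases h0 : c₀ c = c₀ c'
  · by_cases hp : p c = p c'
    · -- same value at `z₁`, same slope along `d`: the slopes along `Q` differ
      have hq : q c ≠ q c' := by
        intro hq; exact hne (by rw [h0, hp, hq])
      rw [show c₀ c + t * (p c + v * q c) - (c₀ c' + t * (p c' + v * q c')) = t * v * (q c - q c') by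
        rw [h0, hp]; ring, abs_mul, abs_mul, abs_of_pos ht, abs_of_pos hv]
      have h1 := hg'sep c hc c' hc' hq
      nlinarith
    · -- same value at `z₁`, different slopes along `d`
      have h1 := hgsep c hc c' hc' hp
      have h2 : |q c - q c'| ≤ 2 * R := (abs_sub _ _).trans (by linarith [hRq c hc, hRq c' hc'])
      have h3 : t * (g - v * (2 * R)) ≤ |c₀ c + t * (p c + v * q c) - (c₀ c' + t * (p c' + v * q c'))| := by
        rw [show c₀ c + t * (p c + v * q c) - (c₀ c' + t * (p c' + v * q c')) =
          t * ((p c - p c') + v * (q c - q c')) by rw [h0]; ring, abs_mul, abs_of_pos ht]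
        refine mul_le_mul_of_nonneg_left ?_ ht.le
        have h4 := abs_sub_abs_le_abs_sub (p c - p c') (-(v * (q c - q c')))
        rw [abs_neg, abs_mul, abs_of_pos hv, sub_neg_eq_add] at h4
        nlinarith
      nlinarith
  · -- different values at `z₁`
    have h1 := hGsep c hc c' hc' h0
    have h2 : |t * ((p c - p c') + v * (q c - q c'))| ≤ 4 * t * R := by
      rw [abs_mul, abs_of_pos ht]
      have hp2 : |p c - p c'| ≤ 2 * R := (abs_sub _ _).trans (by linarith [hRp c hc, hRp c' hc'])
      have hq2 : |q c - q c'| ≤ 2 * R := (abs_sub _ _).trans (by linarith [hRq c hc, hRq c' hc'])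
      have h3 : |(p c - p c') + v * (q c - q c')| ≤ 2 * R + v * (2 * R) := by
        calc |(p c - p c') + v * (q c - q c')| ≤ |p c - p c'| + |v * (q c - q c')| := abs_add_le _ _
          _ = |p c - p c'| + v * |q c - q c'| := by rw [abs_mul, abs_of_pos hv]
          _ ≤ 2 * R + v * (2 * R) := add_le_add hp2 (mul_le_mul_of_nonneg_left hq2 hv.le)
      have h4 : |(p c - p c') + v * (q c - q c')| ≤ 4 * R := by nlinarith
      calc t * |(p c - p c') + v * (q c - q c')| ≤ t * (4 * R) := mul_le_mul_of_nonneg_left h4 ht.le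
        _ = 4 * t * R := by ring
    have h3 : |c₀ c - c₀ c'| - |t * ((p c - p c') + v * (q c - q c'))| ≤
        |c₀ c + t * (p c + v * q c) - (c₀ c' + t * (p c' + v * q c'))| := by
      have e : c₀ c - c₀ c' = (c₀ c + t * (p c + v * q c) - (c₀ c' + t * (p c' + v * q c'))) -
          t * ((p c - p c') + v * (q c - q c')) := by ring
      have := abs_sub (c₀ c + t * (p c + v * q c) - (c₀ c' + t * (p c' + v * q c')))
        (t * ((p c - p c') + v * (q c - q c')))
      rw [← e] at this
      linarith
    nlinarith

/-- **One `u`-contraction step with factor `s ∈ [1/4, 1]`** costs `9^{k·#U}`. -/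
theorem lmass_ucontract_nine (lo hi : Fin k → Fin k ⊕ ι) (a : Fin k → Option ι) (U : Finset ι)
    (hlo : ∀ i c, lo i = Sum.inr c → c ∈ U) (hhi : ∀ i c, hi i = Sum.inr c → c ∈ U)
    (ha : ∀ i c, a i = some c → c ∈ U) (c₀ p q r : ι → ℝ) (G g g' R : ℝ) (hR : 0 < R)
    (hGsep : ∀ c ∈ U, ∀ c' ∈ U, c₀ c ≠ c₀ c' → G ≤ |c₀ c - c₀ c'|)
    (hgsep : ∀ c ∈ U, ∀ c' ∈ U, p c ≠ p c' → g ≤ |p c - p c'|)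
    (hg'sep : ∀ c ∈ U, ∀ c' ∈ U, q c ≠ q c' → g' ≤ |q c - q c'|)
    (hRp : ∀ c ∈ U, |p c| ≤ R) (hRq : ∀ c ∈ U, |q c| ≤ R) (hRr : ∀ c ∈ U, |r c| ≤ R)
    {t v u u' : ℝ} (ht : 0 < t) (htG : t ≤ G / (28 * R)) (hv : 0 < v) (hv1 : v ≤ 1)
    (hvg : v ≤ g / (16 * R)) (hu : 0 < u) (huu' : u ≤ u') (hu'u : u' ≤ 4 * u) (hu'1 : u' ≤ 1)
    (hu'g : u' ≤ g' / (14 * R)) :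
    lmass lo hi a (fun c => c₀ c + t * (p c + v * (q c + u * r c))) ≤
      (9 : ℝ≥0∞) ^ (k * U.card) * lmass lo hi a (fun c => c₀ c + t * (p c + v * (q c + u' * r c))) := by
  have hu'0 : 0 < u' := lt_of_lt_of_le hu huu'
  refine lmass_contract_nine lo hi a U hlo hhi ha _ _ (fun c => c₀ c + t * (p c + v * q c)) (u / u')
    (2 * t * v * u' * R) ⟨?_, (div_le_one hu'0).2 huu'⟩ (by positivity) ?_
    (anchors_sep3 U c₀ p q hR hGsep hgsep hg'sep hRp hRq ht htG hv hv1 hvg hu'1 hu'g) ?_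
  · rw [le_div_iff₀ hu'0]; linarith
  · intro c hc
    rw [show c₀ c + t * (p c + v * (q c + u' * r c)) - (c₀ c + t * (p c + v * q c)) =
      t * (v * (u' * r c)) by ring, abs_mul, abs_of_pos ht, abs_mul, abs_of_pos hv, abs_mul,
      abs_of_pos hu'0]
    have h1 : u' * |r c| ≤ u' * R := mul_le_mul_of_nonneg_left (hRr c hc) hu'0.le
    nlinarith [mul_pos ht hv]
  · intro c _
    rw [show c₀ c + t * (p c + v * (q c + u' * r c)) - (c₀ c + t * (p c + v * q c)) =
      t * (v * (u' * r c)) by ring]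
    field_simp
    ring

/-- **Contracting the third variable costs a logarithm.** -/
theorem lmass_ulog3 (lo hi : Fin k → Fin k ⊕ ι) (a : Fin k → Option ι) (U : Finset ι)
    (hlo : ∀ i c, lo i = Sum.inr c → c ∈ U) (hhi : ∀ i c, hi i = Sum.inr c → c ∈ U)
    (ha : ∀ i c, a i = some c → c ∈ U) (c₀ p q r : ι → ℝ) (G g g' R : ℝ) (hR : 0 < R)
    (hGsep : ∀ c ∈ U, ∀ c' ∈ U, c₀ c ≠ c₀ c' → G ≤ |c₀ c - c₀ c'|)
    (hgsep : ∀ c ∈ U, ∀ c' ∈ U, p c ≠ p c' → g ≤ |p c - p c'|)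
    (hg'sep : ∀ c ∈ U, ∀ c' ∈ U, q c ≠ q c' → g' ≤ |q c - q c'|)
    (hRp : ∀ c ∈ U, |p c| ≤ R) (hRq : ∀ c ∈ U, |q c| ≤ R) (hRr : ∀ c ∈ U, |r c| ≤ R)
    {t v u u' : ℝ} (ht : 0 < t) (htG : t ≤ G / (28 * R)) (hv : 0 < v) (hv1 : v ≤ 1)
    (hvg : v ≤ g / (16 * R)) (hu : 0 < u) (huu' : u ≤ u') (hu'1 : u' ≤ 1)
    (hu'g : u' ≤ g' / (14 * R)) :
    lmass lo hi a (fun c => c₀ c + t * (p c + v * (q c + u * r c))) ≤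
      ENNReal.ofReal (5 * (1 + Real.log (u' / u))) ^ (k * U.card) *
        lmass lo hi a (fun c => c₀ c + t * (p c + v * (q c + u' * r c))) := by
  have hu'0 : 0 < u' := lt_of_lt_of_le hu huu'
  set s : ℝ := u / u' with hs_def
  have hs0 : 0 < s := div_pos hu hu'0
  have hs1 : s ≤ 1 := (div_le_one hu'0).2 huu'
  set ℓ : ℝ := 2 * t * v * u' * R with hℓ_def
  have hℓ : 0 < ℓ := by positivity
  have hw1 : 1 ≤ wexp ℓ (2 * ℓ) s := one_le_wexp ⟨hℓ, le_rfl, hs0, hs1⟩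
  have hA1 : (1 : ℝ) ≤ 3 * wexp ℓ (2 * ℓ) s := by linarith
  have hA5 : 3 * wexp ℓ (2 * ℓ) s ≤ 5 * (1 + Real.log (u' / u)) := by
    have := three_wexp_le hℓ hs0 hs1
    rwa [hs_def, inv_div] at this
  have hsep := anchors_sep3 U c₀ p q hR hGsep hgsep hg'sep hRp hRq ht htG hv hv1 hvg hu'1 hu'g
  have h := lmass_contract lo hi a U hlo hhi ha (fun c => c₀ c + t * (p c + v * (q c + u' * r c)))
    (fun c => c₀ c + t * (p c + v * (q c + u * r c))) (fun c => c₀ c + t * (p c + v * q c)) s ℓ (2 * ℓ)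
    (3 * wexp ℓ (2 * ℓ) s) hA1 ⟨hs0, hs1⟩ ⟨hℓ, le_rfl⟩ ?_ ?_ ?_
    (fun m => hwin_of_window hℓ le_rfl hs0 hs1 m)
  · calc lmass lo hi a (fun c => c₀ c + t * (p c + v * (q c + u * r c)))
        ≤ ENNReal.ofReal (3 * wexp ℓ (2 * ℓ) s) ^ (k * U.card) *
            lmass lo hi a (fun c => c₀ c + t * (p c + v * (q c + u' * r c))) := h
      _ ≤ ENNReal.ofReal (5 * (1 + Real.log (u' / u))) ^ (k * U.card) *
            lmass lo hi a (fun c => c₀ c + t * (p c + v * (q c + u' * r c))) := by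
          gcongr
  · intro c hc
    show |c₀ c + t * (p c + v * (q c + u' * r c)) - (c₀ c + t * (p c + v * q c))| ≤ ℓ / 2
    rw [show c₀ c + t * (p c + v * (q c + u' * r c)) - (c₀ c + t * (p c + v * q c)) =
      t * (v * (u' * r c)) by ring, abs_mul, abs_of_pos ht, abs_mul, abs_of_pos hv, abs_mul,
      abs_of_pos hu'0, hℓ_def]
    have h1 : u' * |r c| ≤ u' * R := mul_le_mul_of_nonneg_left (hRr c hc) hu'0.le
    nlinarith [mul_pos ht hv]
  · intro c hc c' hc' hne
    show 3 * (2 * ℓ) + ℓ ≤ |c₀ c + t * (p c + v * q c) - (c₀ c' + t * (p c' + v * q c'))|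
    have := hsep c hc c' hc' hne
    rw [hℓ_def]; linarith
  · intro c _
    show c₀ c + t * (p c + v * (q c + u * r c)) =
      c₀ c + t * (p c + v * q c) + s * (c₀ c + t * (p c + v * (q c + u' * r c)) - (c₀ c + t * (p c + v * q c)))
    rw [hs_def]
    field_simp
    ring

/-- **The fibre mass along a nested sector is almost decreasing towards the corner.** Moving
from `(t', v', u')` to `(t, v, u)` with `t ≤ t' ≤ 4t`, `v ≤ v' ≤ 4v`, `u ≤ u' ≤ 4u` multiplies
the fibre mass by at most `81^{k·#U} · 9^{k·#U}`, in the range `t' ≤ G/(56R)`,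
`v' ≤ min 1 (g/(28R))`, `u' ≤ min 1 (g'/(14R))`. -/
theorem lmass_corner_mono3 (lo hi : Fin k → Fin k ⊕ ι) (a : Fin k → Option ι) (U : Finset ι)
    (hlo : ∀ i c, lo i = Sum.inr c → c ∈ U) (hhi : ∀ i c, hi i = Sum.inr c → c ∈ U)
    (ha : ∀ i c, a i = some c → c ∈ U) (c₀ p q r : ι → ℝ) (G g g' R : ℝ) (hR : 0 < R)
    (hGsep : ∀ c ∈ U, ∀ c' ∈ U, c₀ c ≠ c₀ c' → G ≤ |c₀ c - c₀ c'|)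
    (hgsep : ∀ c ∈ U, ∀ c' ∈ U, p c ≠ p c' → g ≤ |p c - p c'|)
    (hg'sep : ∀ c ∈ U, ∀ c' ∈ U, q c ≠ q c' → g' ≤ |q c - q c'|)
    (hRp : ∀ c ∈ U, |p c| ≤ R) (hRq : ∀ c ∈ U, |q c| ≤ R) (hRr : ∀ c ∈ U, |r c| ≤ R)
    {t t' v v' u u' : ℝ} (ht : 0 < t) (htt' : t ≤ t') (ht't : t' ≤ 4 * t) (ht' : t' ≤ G / (56 * R))
    (hv : 0 < v) (hvv' : v ≤ v') (hv'v : v' ≤ 4 * v) (hv'1 : v' ≤ 1) (hv'g : v' ≤ g / (28 * R))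
    (hu : 0 < u) (huu' : u ≤ u') (hu'u : u' ≤ 4 * u) (hu'1 : u' ≤ 1) (hu'g : u' ≤ g' / (14 * R)) :
    lmass lo hi a (fun c => c₀ c + t * (p c + v * (q c + u * r c))) ≤
      (9 : ℝ≥0∞) ^ (k * U.card) * (9 : ℝ≥0∞) ^ (k * U.card) * (9 : ℝ≥0∞) ^ (k * U.card) *
        lmass lo hi a (fun c => c₀ c + t' * (p c + v' * (q c + u' * r c))) := by
  have ht'0 : 0 < t' := lt_of_lt_of_le ht htt'
  have hv'0 : 0 < v' := lt_of_lt_of_le hv hvv'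
  have hu1 : |u| ≤ 1 := by rw [abs_of_pos hu]; linarith
  have hR2 : 0 < 2 * R := by positivity
  -- the two-parameter step at fixed `u`
  have h1 : lmass lo hi a (fun c => c₀ c + t * (p c + v * (q c + u * r c))) ≤
      (9 : ℝ≥0∞) ^ (k * U.card) * (9 : ℝ≥0∞) ^ (k * U.card) *
        lmass lo hi a (fun c => c₀ c + t' * (p c + v' * (q c + u * r c))) := by
    rw [nest_eq c₀ p q r t v u, nest_eq c₀ p q r t' v' u]
    refine lmass_corner_mono lo hi a U hlo hhi ha c₀ p (fun c => q c + u * r c) G g (2 * R) hR2 hGsep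
      hgsep (abs_le_two_mul hR hRp) (abs_q_add_le hRq hRr hu1) ht htt' ht't ?_ hv hvv' hv'v hv'1 ?_
    · rw [show 28 * (2 * R) = 56 * R by ring]; exact ht'
    · rw [show 14 * (2 * R) = 28 * R by ring]; exact hv'g
  -- the `u`-step at `(t', v')`
  have h2 : lmass lo hi a (fun c => c₀ c + t' * (p c + v' * (q c + u * r c))) ≤
      (9 : ℝ≥0∞) ^ (k * U.card) * lmass lo hi a (fun c => c₀ c + t' * (p c + v' * (q c + u' * r c))) := by
    refine lmass_ucontract_nine lo hi a U hlo hhi ha c₀ p q r G g g' R hR hGsep hgsep hg'sep hRp hRq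
      hRr ht'0 ?_ hv'0 hv'1 ?_ hu huu' hu'u hu'1 hu'g
    · have : G / (56 * R) ≤ G / (28 * R) := by
        by_cases hG : 0 ≤ G
        · exact div_le_div_of_nonneg_left hG (by positivity) (by linarith)
        · push Not at hG
          have h56 : G / (56 * R) < 0 := div_neg_of_neg_of_pos hG (by positivity)
          linarith [ht'0]
      exact ht'.trans this
    · have : g / (28 * R) ≤ g / (16 * R) := by
        by_cases hg : 0 ≤ g
        · exact div_le_div_of_nonneg_left hg (by positivity) (by linarith)
        · push Not at hg
          have h28 : g / (28 * R) < 0 := div_neg_of_neg_of_pos hg (by positivity)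
          linarith [hv'0]
      exact hv'g.trans this
  calc lmass lo hi a (fun c => c₀ c + t * (p c + v * (q c + u * r c)))
      ≤ (9 : ℝ≥0∞) ^ (k * U.card) * (9 : ℝ≥0∞) ^ (k * U.card) *
          lmass lo hi a (fun c => c₀ c + t' * (p c + v' * (q c + u * r c))) := h1
    _ ≤ (9 : ℝ≥0∞) ^ (k * U.card) * (9 : ℝ≥0∞) ^ (k * U.card) * ((9 : ℝ≥0∞) ^ (k * U.card) *
          lmass lo hi a (fun c => c₀ c + t' * (p c + v' * (q c + u' * r c)))) := mul_le_mul_right h2 _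
    _ = _ := by ring

/-- **Contracting the radial variable costs a logarithm** (three parameters). -/
theorem lmass_tlog3 (lo hi : Fin k → Fin k ⊕ ι) (a : Fin k → Option ι) (U : Finset ι)
    (hlo : ∀ i c, lo i = Sum.inr c → c ∈ U) (hhi : ∀ i c, hi i = Sum.inr c → c ∈ U)
    (ha : ∀ i c, a i = some c → c ∈ U) (c₀ p q r : ι → ℝ) (G R : ℝ) (hR : 0 < R)
    (hGsep : ∀ c ∈ U, ∀ c' ∈ U, c₀ c ≠ c₀ c' → G ≤ |c₀ c - c₀ c'|)
    (hRp : ∀ c ∈ U, |p c| ≤ R) (hRq : ∀ c ∈ U, |q c| ≤ R) (hRr : ∀ c ∈ U, |r c| ≤ R)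
    {t t' v u : ℝ} (ht : 0 < t) (htt' : t ≤ t') (ht' : t' ≤ G / (56 * R)) (hv : |v| ≤ 1)
    (hu : |u| ≤ 1) :
    lmass lo hi a (fun c => c₀ c + t * (p c + v * (q c + u * r c))) ≤
      ENNReal.ofReal (5 * (1 + Real.log (t' / t))) ^ (k * U.card) *
        lmass lo hi a (fun c => c₀ c + t' * (p c + v * (q c + u * r c))) := by
  have hR2 : 0 < 2 * R := by positivity
  rw [nest_eq c₀ p q r t v u, nest_eq c₀ p q r t' v u]
  refine lmass_radial_log lo hi a U hlo hhi ha c₀ p (fun c => q c + u * r c) G (2 * R) hR2 hGsep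
    (abs_le_two_mul hR hRp) (abs_q_add_le hRq hRr hu) ht htt' ?_ hv
  rw [show 28 * (2 * R) = 56 * R by ring]; exact ht'

/-- **Contracting the first angular variable costs a logarithm** (three parameters). -/
theorem lmass_vlog3 (lo hi : Fin k → Fin k ⊕ ι) (a : Fin k → Option ι) (U : Finset ι)
    (hlo : ∀ i c, lo i = Sum.inr c → c ∈ U) (hhi : ∀ i c, hi i = Sum.inr c → c ∈ U)
    (ha : ∀ i c, a i = some c → c ∈ U) (c₀ p q r : ι → ℝ) (G g R : ℝ) (hR : 0 < R)
    (hGsep : ∀ c ∈ U, ∀ c' ∈ U, c₀ c ≠ c₀ c' → G ≤ |c₀ c - c₀ c'|)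
    (hgsep : ∀ c ∈ U, ∀ c' ∈ U, p c ≠ p c' → g ≤ |p c - p c'|)
    (hRp : ∀ c ∈ U, |p c| ≤ R) (hRq : ∀ c ∈ U, |q c| ≤ R) (hRr : ∀ c ∈ U, |r c| ≤ R)
    {t v v' u : ℝ} (ht : 0 < t) (ht' : t ≤ G / (56 * R)) (hv : 0 < v) (hvv' : v ≤ v')
    (hv'1 : v' ≤ 1) (hv'g : v' ≤ g / (28 * R)) (hu : |u| ≤ 1) :
    lmass lo hi a (fun c => c₀ c + t * (p c + v * (q c + u * r c))) ≤
      ENNReal.ofReal (5 * (1 + Real.log (v' / v))) ^ (k * U.card) *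
        lmass lo hi a (fun c => c₀ c + t * (p c + v' * (q c + u * r c))) := by
  have hR2 : 0 < 2 * R := by positivity
  rw [nest_eq c₀ p q r t v u, nest_eq c₀ p q r t v' u]
  refine lmass_angular_log lo hi a U hlo hhi ha c₀ p (fun c => q c + u * r c) G g (2 * R) hR2 hGsep
    hgsep (abs_le_two_mul hR hRp) (abs_q_add_le hRq hRr hu) ht ?_ hv hvv' hv'1 ?_
  · rw [show 28 * (2 * R) = 56 * R by ring]; exact ht'
  · rw [show 14 * (2 * R) = 28 * R by ring]; exact hv'g

end SepHHK

/-- **The fibre mass along a nested thin sector is almost decreasing towards the corner**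
(registered part of `stub_separateHigh`, base dimension `3` with fibres; literal form of
`SepHHK.lmass_corner_mono3`): with atom values `c₀ c + t (p c + v (q c + u · r c))`, moving
towards the corner within ratio `4` in each of the three blow-up variables multiplies the fibre
mass by at most `81^{k·#U} · 9^{k·#U}`. -/
theorem separateThreeHHK_mass (k : ℕ) (ι : Type) (lo hi : Fin k → Fin k ⊕ ι) (a : Fin k → Option ι) (U : Finset ι) (hlo : ∀ i c, lo i = Sum.inr c → c ∈ U) (hhi : ∀ i c, hi i = Sum.inr c → c ∈ U) (ha : ∀ i c, a i = some c → c ∈ U) (c₀ p q r : ι → ℝ) (G g g' R : ℝ) (hR : 0 < R) (hGsep : ∀ c ∈ U, ∀ c' ∈ U, c₀ c ≠ c₀ c' → G ≤ |c₀ c - c₀ c'|) (hgsep : ∀ c ∈ U, ∀ c' ∈ U, p c ≠ p c' → g ≤ |p c - p c'|) (hg'sep : ∀ c ∈ U, ∀ c' ∈ U, q c ≠ q c' → g' ≤ |q c - q c'|) (hRp : ∀ c ∈ U, |p c| ≤ R) (hRq : ∀ c ∈ U, |q c| ≤ R) (hRr : ∀ c ∈ U, |r c| ≤ R) (t t' v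 v' u u' : ℝ) (ht : 0 < t) (htt' : t ≤ t') (ht't : t' ≤ 4 * t) (ht' : t' ≤ G / (56 * R)) (hv : 0 < v) (hvv' : v ≤ v') (hv'v : v' ≤ 4 * v) (hv'1 : v' ≤ 1) (hv'g : v' ≤ g / (28 * R)) (hu : 0 < u) (huu' : u ≤ u') (hu'u : u' ≤ 4 * u) (hu'1 : u' ≤ 1) (hu'g : u' ≤ g' / (14 * R)) : MeasureTheory.lintegral (MeasureTheory.volume.restrict {x : Fin k → ℝ | ∀ i, Sum.elim x (fun c => c₀ c + t * (p c + v * (q c + u * r c))) (lo i) < x i ∧ x i < Sum.elim x (fun c => c₀ c + t * (p c + v * (q c + u * r c))) (hi i)}) (fun x => ∏ i, (a i).elim 1 (fun c => ENNReal.ofReal |x i - (c₀ c + t * (p c + v * (q c + u * r c)))|⁻¹)) ≤ (9 : ENNReal) ^ (k * U.card) * (9 : ENNReal) ^ (k * U.card) * (9 : ENNReal) ^ (k * U.card) * MeasureTheory.lintegral (MeasureTheory.volume.restrict {x : Fin k → ℝ | ∀ i, Sum.elim x (fun c => c₀ c + t' * (p c + v' * (q c + u' * r c))) (lo i) < x i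 ∧ x i < Sum.elim x (fun c => c₀ c + t' * (p c + v' * (q c + u' * r c))) (hi i)}) (fun x => ∏ i, (a i).elim 1 (fun c => ENNReal.ofReal |x i - (c₀ c + t' * (p c + v' * (q c + u' * r c)))|⁻¹)) := by
  exact SepHHK.lmass_corner_mono3 lo hi a U hlo hhi ha c₀ p q r G g g' R hR hGsep hgsep hg'sep hRp hRq hRr ht htt' ht't ht' hv hvv' hv'v hv'1 hv'g hu huu' hu'u hu'1 hu'g

end Summit.KontsevichZagierPeriods.ArrangementNormalForm.JanusBands
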